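import Summits.CriticalPhenomena.PercolationContinuityZ3.Theses.PercNearOneGluing
import Summits.CriticalPhenomena.PercolationContinuityZ3.Theorems.PercNearOneGluingAdditiveGluingOffClusterAssociation
import HarnessLib

/-!
# Crux `PercNearOneGluing.AdditiveGluing` (stmt-CriticalPhenomena-4576), line `tieline`: the conditional connection
# lower bound (7b)

Support file (`--supports stmt-CriticalPhenomena-4576`, helper, lead c11).  No definitions, no named facts, no sorries.

Weighted graph on `Fin n` (`μ = prodBernoulli w`), relays `u, v`, observer `o`, spectator `c`; `D = {u ↮ v}`,
`N = {c ↮ u} ∩ {c ↮ v}` ("`c` free of both clusters").  Lemma (7b) of the line: given `u ↮ v`, conditioning on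
`c ∈ C_v` makes `o ∈ C_v` at least as likely as `o ↔ c` is given `c` free,

  (7b)  `P_D(o ↔ v | c ↔ v) ≥ π := P_D(o ↔ c | c ↮ u, c ↮ v)`,  `P_D = P( · | u ↮ v)`,

in the division-free form `μ(D ∩ N ∩ {o↔c}) · μ(D ∩ {v↔c}) ≤ μ(D ∩ N) · μ(D ∩ {v↔c} ∩ {v↔o})`.

Proof.  Put `F = {u ↮ v} ∩ {u ↮ c}` (`C_u` avoids `{v, c}`).  Then `D ∩ {v↔c} = F ∩ {c↔v}`, `D ∩ N = F ∩ {c↮v}`, and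
on `F` both `{c ↔ o}` and `{c ↔ v}` are `u`-free connection events (increasing events of the configuration off the
cluster `C̄_u`), hence positively correlated given `F` by the off-cluster association engine, row (E1)
`OffCluster.sFreeConn_posAssoc` (van den Berg–Häggström–Kahn, Thm. 1.5 with Thm. 1.3):
`μ(F ∩ {c↔o}) · μ(F ∩ {c↔v}) ≤ μ(F) · μ(F ∩ {c↔o} ∩ {c↔v})`.
Splitting `μ(F ∩ {c↔o}) = μ(D ∩ N ∩ {o↔c}) + μ(D ∩ {v↔c} ∩ {v↔o})` and `μ(F) = μ(D ∩ N) + μ(D ∩ {v↔c})` along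
`{c ↔ v}`, the cross terms cancel and (7b) remains.  The degenerate cases `u = v`, `u = c` read `0 ≤ 0`.
[cite: VandenbergHaggstromKahn2005, Thm. 1.3 (p. 6), Thm. 1.5 (p. 7), proof pp. 7–8 — corollary]
-/

namespace Summit.CriticalPhenomena.PercolationContinuityZ3.Cruxes.AdditiveGluing.TieLine

open MeasureTheory Set Literature.Probability.LatticeModels Literature.Probability.Percolation

noncomputable section

namespace CondConnLowerBound

variable {n : ℕ}

/-! ### Set identities (`F = {ω | ∀ x ∈ {v, c}, ¬ u ↔ x} = {u ↮ v} ∩ {u ↮ c}`) -/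

/-- `F ∩ ({c↔v} ∩ {c↮u}) = D ∩ {v↔c}` (`v ↔ c` and `u ↮ v` force `u ↮ c`). [folklore] -/
theorem F_cv_eq (u v c : Fin n) :
    ({ω : BondConfig (Fin n) | ∀ x ∈ ({v, c} : Set (Fin n)), ¬ (openGraph ω).Reachable u x} ∩
        (openConn c v ∩ (openConn c u)ᶜ) : Set (BondConfig (Fin n))) = (openConn u v)ᶜ ∩ openConn v c := by
  ext ω
  simp only [mem_inter_iff, mem_compl_iff, mem_setOf_eq, mem_insert_iff, mem_singleton_iff, forall_eq_or_imp,
    forall_eq, openConn]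
  constructor
  · rintro ⟨⟨huv, -⟩, hcv, -⟩
    exact ⟨huv, hcv.symm⟩
  · rintro ⟨huv, hvc⟩
    exact ⟨⟨huv, fun huc => huv (huc.trans hvc.symm)⟩, hvc.symm, fun hcu => huv (hcu.symm.trans hvc.symm)⟩

/-- `F ∩ (({c↔o} ∩ {c↮u}) ∩ ({c↔v} ∩ {c↮u})) = D ∩ {v↔c} ∩ {v↔o}`. [folklore] -/
theorem F_co_cv_eq (o u v c : Fin n) :
    ({ω : BondConfig (Fin n) | ∀ x ∈ ({v, c} : Set (Fin n)), ¬ (openGraph ω).Reachable u x} ∩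
        ((openConn c o ∩ (openConn c u)ᶜ) ∩ (openConn c v ∩ (openConn c u)ᶜ)) : Set (BondConfig (Fin n))) =
      (openConn u v)ᶜ ∩ openConn v c ∩ openConn v o := by
  ext ω
  simp only [mem_inter_iff, mem_compl_iff, mem_setOf_eq, mem_insert_iff, mem_singleton_iff, forall_eq_or_imp,
    forall_eq, openConn]
  constructor
  · rintro ⟨⟨huv, -⟩, ⟨hco, -⟩, hcv, -⟩
    exact ⟨⟨huv, hcv.symm⟩, hcv.symm.trans hco⟩
  · rintro ⟨⟨huv, hvc⟩, hvo⟩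
    have hcu : ¬ (openGraph ω).Reachable c u := fun hcu => huv (hcu.symm.trans hvc.symm)
    exact ⟨⟨huv, fun huc => hcu huc.symm⟩, ⟨hvc.symm.trans hvo, hcu⟩, hvc.symm, hcu⟩

/-- `F ∩ ({c↔o} ∩ {c↮u}) ∩ {c↮v} = D ∩ N ∩ {o↔c}`. [folklore] -/
theorem F_co_free_eq (o u v c : Fin n) :
    ({ω : BondConfig (Fin n) | ∀ x ∈ ({v, c} : Set (Fin n)), ¬ (openGraph ω).Reachable u x} ∩
        (openConn c o ∩ (openConn c u)ᶜ) ∩ (openConn c v)ᶜ : Set (BondConfig (Fin n))) =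
      (openConn u v)ᶜ ∩ ((openConn c u)ᶜ ∩ (openConn c v)ᶜ) ∩ openConn o c := by
  ext ω
  simp only [mem_inter_iff, mem_compl_iff, mem_setOf_eq, mem_insert_iff, mem_singleton_iff, forall_eq_or_imp,
    forall_eq, openConn]
  constructor
  · rintro ⟨⟨⟨huv, -⟩, hco, hcu⟩, hcv⟩
    exact ⟨⟨huv, hcu, hcv⟩, hco.symm⟩
  · rintro ⟨⟨huv, hcu, hcv⟩, hoc⟩
    exact ⟨⟨⟨huv, fun huc => hcu huc.symm⟩, hoc.symm, hcu⟩, hcv⟩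

/-- `F ∩ ({c↔o} ∩ {c↮u}) ∩ {c↔v} = D ∩ {v↔c} ∩ {v↔o}`. [folklore] -/
theorem F_co_conn_eq (o u v c : Fin n) :
    ({ω : BondConfig (Fin n) | ∀ x ∈ ({v, c} : Set (Fin n)), ¬ (openGraph ω).Reachable u x} ∩
        (openConn c o ∩ (openConn c u)ᶜ) ∩ openConn c v : Set (BondConfig (Fin n))) =
      (openConn u v)ᶜ ∩ openConn v c ∩ openConn v o := by
  ext ω
  simp only [mem_inter_iff, mem_compl_iff, mem_setOf_eq, mem_insert_iff, mem_singleton_iff, forall_eq_or_imp,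
    forall_eq, openConn]
  constructor
  · rintro ⟨⟨⟨huv, -⟩, hco, -⟩, hcv⟩
    exact ⟨⟨huv, hcv.symm⟩, hcv.symm.trans hco⟩
  · rintro ⟨⟨huv, hvc⟩, hvo⟩
    have hcu : ¬ (openGraph ω).Reachable c u := fun hcu => huv (hcu.symm.trans hvc.symm)
    exact ⟨⟨⟨huv, fun huc => hcu huc.symm⟩, hvc.symm.trans hvo, hcu⟩, hvc.symm⟩

/-- `F ∩ {c↮v} = D ∩ N`. [folklore] -/
theorem F_free_eq (u v c : Fin n) :
    ({ω : BondConfig (Fin n) | ∀ x ∈ ({v, c} : Set (Fin n)), ¬ (openGraph ω).Reachable u x} ∩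
        (openConn c v)ᶜ : Set (BondConfig (Fin n))) = (openConn u v)ᶜ ∩ ((openConn c u)ᶜ ∩ (openConn c v)ᶜ) := by
  ext ω
  simp only [mem_inter_iff, mem_compl_iff, mem_setOf_eq, mem_insert_iff, mem_singleton_iff, forall_eq_or_imp,
    forall_eq, openConn]
  constructor
  · rintro ⟨⟨huv, huc⟩, hcv⟩
    exact ⟨huv, fun hcu => huc hcu.symm, hcv⟩
  · rintro ⟨huv, hcu, hcv⟩
    exact ⟨⟨huv, fun huc => hcu huc.symm⟩, hcv⟩

/-- `F ∩ {c↔v} = D ∩ {v↔c}`. [folklore] -/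
theorem F_conn_eq (u v c : Fin n) :
    ({ω : BondConfig (Fin n) | ∀ x ∈ ({v, c} : Set (Fin n)), ¬ (openGraph ω).Reachable u x} ∩
        openConn c v : Set (BondConfig (Fin n))) = (openConn u v)ᶜ ∩ openConn v c := by
  ext ω
  simp only [mem_inter_iff, mem_compl_iff, mem_setOf_eq, mem_insert_iff, mem_singleton_iff, forall_eq_or_imp,
    forall_eq, openConn]
  constructor
  · rintro ⟨⟨huv, -⟩, hcv⟩
    exact ⟨huv, hcv.symm⟩
  · rintro ⟨huv, hvc⟩
    exact ⟨⟨huv, fun huc => huv (huc.trans hvc.symm)⟩, hvc.symm⟩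

/-! ### Measure splits -/

/-- `μ(S) = μ(S ∩ Tᶜ) + μ(S ∩ T)` for the (finite, discrete) product measure. [folklore] -/
theorem real_split (w : Sym2 (Fin n) → unitInterval) (S T : Set (BondConfig (Fin n))) :
    (prodBernoulli w).real S = (prodBernoulli w).real (S ∩ Tᶜ) + (prodBernoulli w).real (S ∩ T) := by
  rw [← Set.sdiff_eq, add_comm, measureReal_inter_add_sdiff (Set.toFinite _).measurableSet]

/-- `μ(F ∩ {c↔o} ∩ {c↮u}) = μ(D ∩ N ∩ {o↔c}) + μ(D ∩ {v↔c} ∩ {v↔o})`. [folklore] -/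
theorem real_F_co_eq (w : Sym2 (Fin n) → unitInterval) (o u v c : Fin n) :
    (prodBernoulli w).real ({ω : BondConfig (Fin n) | ∀ x ∈ ({v, c} : Set (Fin n)), ¬ (openGraph ω).Reachable u x} ∩
        (openConn c o ∩ (openConn c u)ᶜ) : Set (BondConfig (Fin n))) =
      (prodBernoulli w).real ((openConn u v)ᶜ ∩ ((openConn c u)ᶜ ∩ (openConn c v)ᶜ) ∩ openConn o c :
          Set (BondConfig (Fin n))) +
        (prodBernoulli w).real ((openConn u v)ᶜ ∩ openConn v c ∩ openConn v o : Set (BondConfig (Fin n))) := by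
  rw [real_split w _ (openConn c v), F_co_free_eq, F_co_conn_eq]

/-- `μ(F) = μ(D ∩ N) + μ(D ∩ {v↔c})`. [folklore] -/
theorem real_F_eq (w : Sym2 (Fin n) → unitInterval) (u v c : Fin n) :
    (prodBernoulli w).real {ω : BondConfig (Fin n) | ∀ x ∈ ({v, c} : Set (Fin n)), ¬ (openGraph ω).Reachable u x} =
      (prodBernoulli w).real ((openConn u v)ᶜ ∩ ((openConn c u)ᶜ ∩ (openConn c v)ᶜ) : Set (BondConfig (Fin n))) +
        (prodBernoulli w).real ((openConn u v)ᶜ ∩ openConn v c : Set (BondConfig (Fin n))) := by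
  rw [real_split w _ (openConn c v), F_free_eq, F_conn_eq]

/-- Degenerate case `u ∈ {v, c}`: `D ∩ N ∩ {o↔c} = ∅` (`u ↮ u` is absurd). [folklore] -/
theorem free_oc_eq_empty {o u v c : Fin n} (hu : u ∈ ({v, c} : Set (Fin n))) :
    ((openConn u v)ᶜ ∩ ((openConn c u)ᶜ ∩ (openConn c v)ᶜ) ∩ openConn o c : Set (BondConfig (Fin n))) = ∅ := by
  refine Set.eq_empty_of_forall_notMem fun ω hω => ?_
  simp only [mem_inter_iff, mem_compl_iff, openConn, mem_setOf_eq] at hω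
  obtain ⟨⟨huv, hcu, -⟩, -⟩ := hω
  simp only [mem_insert_iff, mem_singleton_iff] at hu
  rcases hu with rfl | rfl
  · exact huv (SimpleGraph.Reachable.refl _)
  · exact hcu (SimpleGraph.Reachable.refl _)

end CondConnLowerBound

open CondConnLowerBound in
/-- **Conditional connection lower bound (7b)** (line `tieline`, crux `AdditiveGluing`; lead c11): with `D = {u ↮ v}`,
`N = {c ↮ u} ∩ {c ↮ v}`:  `μ(D ∩ N ∩ {o↔c}) · μ(D ∩ {v↔c}) ≤ μ(D ∩ N) · μ(D ∩ {v↔c} ∩ {v↔o})`, i.e.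
`P_D(o ↔ v | c ↔ v) ≥ π = P_D(o ↔ c | c free)`.  It is the positive correlation, given `C_u ∩ {v, c} = ∅`, of the two
`u`-free connection events `{c ↔ o}`, `{c ↔ v}` (row (E1) `OffCluster.sFreeConn_posAssoc` of the off-cluster
association engine = van den Berg–Häggström–Kahn Thm. 1.5/1.3), after splitting along `{c ↔ v}`.
[cite: VandenbergHaggstromKahn2005, Thm. 1.3 (p. 6), Thm. 1.5 (p. 7), proof pp. 7–8 — corollary] -/
theorem condConn_lowerBound : ∀ (n : ℕ) (w : Sym2 (Fin n) → unitInterval) (o u v c : Fin n),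
    (Literature.Probability.LatticeModels.prodBernoulli w).real ((Literature.Probability.Percolation.openConn u v)ᶜ ∩ ((Literature.Probability.Percolation.openConn c u)ᶜ ∩ (Literature.Probability.Percolation.openConn c v)ᶜ) ∩ Literature.Probability.Percolation.openConn o c) *
      (Literature.Probability.LatticeModels.prodBernoulli w).real ((Literature.Probability.Percolation.openConn u v)ᶜ ∩ Literature.Probability.Percolation.openConn v c)
    ≤ (Literature.Probability.LatticeModels.prodBernoulli w).real ((Literature.Probability.Percolation.openConn u v)ᶜ ∩ ((Literature.Probability.Percolation.openConn c u)ᶜ ∩ (Literature.Probability.Percolation.openConn c v)ᶜ) : Set (Literature.Probability.Percolation.BondConfig (Fin n))) *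
      (Literature.Probability.LatticeModels.prodBernoulli w).real ((Literature.Probability.Percolation.openConn u v)ᶜ ∩ Literature.Probability.Percolation.openConn v c ∩ Literature.Probability.Percolation.openConn v o) := by
  intro n w o u v c
  by_cases hu : u ∈ ({v, c} : Set (Fin n))
  · -- degenerate: the first factor on the left vanishes
    rw [free_oc_eq_empty hu, measureReal_empty, zero_mul]
    exact mul_nonneg measureReal_nonneg measureReal_nonneg
  · -- (E1) for `s = u`, `X = {v, c}`, events `{c↔o} ∩ {c↮u}`, `{c↔v} ∩ {c↮u}`
    have key := OffCluster.sFreeConn_posAssoc w u ({v, c} : Set (Fin n)) hu c o c v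
    rw [F_cv_eq, F_co_cv_eq, real_F_co_eq, real_F_eq] at key
    linear_combination key

end

end Summit.CriticalPhenomena.PercolationContinuityZ3.Cruxes.AdditiveGluing.TieLine
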